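import Summits.CriticalPhenomena.PercolationContinuityZ3.Theorems.PercNearOneGluingNoHeavyLowerTailSahiCombTriWCertGenBoundary

/-!
# CERT-GEN(q) with no flip (`t = ∅`): the PLAIN certificate (`q = 1`) already has trivial kernel — a first genuinely coupled
# instance of `CertGenKernelAt`, via the LIFTING LEMMA

Support file of the one-cut programme (crux `NoHeavyLowerTail`, stmt-CriticalPhenomena-4575; cell `prim-masterthm`, seat P5 gen 19;
memo `FROM-prim-masterthm-p5-g19-QZETA-CHANNELS.md` §1/§8).  In the configuration `(X, Y, t = ∅)` the third supply family is
`E = refl X ∩ Y` (the set underlying `D₁`); the inequality behind it is two Kleitman inequalities, but the certificate is NOT block-triangular: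
`D₁` and `D₃` share the `A`-copy of `W = X ∩ Y`.  The coupling is resolved by

* **`zeta_sum_eq_zero_lift`** (LIFTING LEMMA): for up-sets `X, Y` and `f` supported below `refl X` (`f d ≠ 0 → dᶜ ∈ X`), a zeta relation
  `Σ_d f d [d ⊆ u] = 0` holding on `X ∩ Y` holds on all of `Y`.  (Expand each `ζ_d|_Y` in the antipodal basis of `Y` — support lemma
  `exists_support_coef`; the coordinates live on `e ⊆ d`, hence inside the down-set `refl X`, i.e. on `refl (X ∩ Y)`; C1 for `X ∩ Y`
  kills them.)  This is the EXTENSION principle dual to "restriction to an up-set is free".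
* **`certGenKernelAt_transl_empty : CertGenKernelAt X Y ∅ 1`**: at `q = 1` equation `(A)` is a zeta relation for `a + c` (supported below
  `refl X`) on `W`; lift it to `Y`; on `refl X ∩ Y = E` subtract `(E)` to isolate `a` (a relation on a family containing `supp a`
  ⇒ `a = 0`, `eq_zero_of_zeta_sum_eq_zero_of_support`); then `c = 0` by C1 for `Y`, and `b = 0` by C2′ (`eq_zero_of_zeta_sum_eq_zero_inter`).
So the typed conjecture `CertGenKernel` now holds (in the tree) on the four families `X = ⊤`, `Y = ⊤`, `t = ⊤`, `t = ∅`; the interior is OPEN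
(there `q = 1` fails and the lifting lemma does not apply to `ζ_q c`).
HONEST LABEL: elementary, all proved (std axioms). [this work]
-/

namespace Summit.CriticalPhenomena.PercolationContinuityZ3.Theorems

namespace FiveUpSet

open Finset

variable {α : Type} [DecidableEq α] [Fintype α]

/-! ### The lifting lemma -/

/-- **LIFTING LEMMA.**  Let `X, Y` be up-sets and `f` supported below `refl X` (`f d ≠ 0 → dᶜ ∈ X`).  If `Σ_d f d [d ⊆ u] = 0` for every
`u ∈ X ∩ Y`, then `Σ_d f d [d ⊆ u] = 0` for every `u ∈ Y`.  Proof: antipodal coordinates in `ℚ^Y` of the restricted zeta functions `ζ_d|_Y`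
are supported on `e ⊆ d` (support lemma), so below `refl X`, i.e. on `refl (X ∩ Y)`; the relation on `X ∩ Y` and C1 for `X ∩ Y` force all
coordinates to vanish, hence the relation on all of `Y`. [this work] -/
theorem zeta_sum_eq_zero_lift (X Y : Finset (Finset α)) (hX : IsUpperSet (X : Set (Finset α)))
    (hY : IsUpperSet (Y : Set (Finset α))) (f : Finset α → ℚ) (hf : ∀ d, f d ≠ 0 → dᶜ ∈ X)
    (h : ∀ u, u ∈ X ∩ Y → ∑ d, f d * (if d ⊆ u then (1 : ℚ) else 0) = 0) :
    ∀ u, u ∈ Y → ∑ d, f d * (if d ⊆ u then (1 : ℚ) else 0) = 0 := by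
  have hW : IsUpperSet ((X ∩ Y : Finset (Finset α)) : Set (Finset α)) := by
    rw [coe_inter]; exact hX.inter hY
  -- antipodal coordinates in `ℚ^Y`
  choose cf hcfδ hcfsupp hcfid using fun d => exists_support_coef hY d
  have transfer : ∀ t ∈ Y,
      ∑ e, (∑ d, f d * cf d e) * (if e ⊆ t then (1 : ℚ) else 0) = ∑ d, f d * (if d ⊆ t then (1 : ℚ) else 0) := by
    intro t ht
    calc ∑ e, (∑ d, f d * cf d e) * (if e ⊆ t then (1 : ℚ) else 0)
        = ∑ e, ∑ d, f d * (cf d e * (if e ⊆ t then (1 : ℚ) else 0)) := by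
          refine sum_congr rfl fun e _ => ?_
          rw [Finset.sum_mul]
          exact sum_congr rfl fun d _ => by ring
      _ = ∑ d, ∑ e, f d * (cf d e * (if e ⊆ t then (1 : ℚ) else 0)) := Finset.sum_comm
      _ = ∑ d, f d * ∑ e, cf d e * (if e ⊆ t then (1 : ℚ) else 0) := by
          refine sum_congr rfl fun d _ => ?_
          rw [Finset.mul_sum]
      _ = ∑ d, f d * (if d ⊆ t then (1 : ℚ) else 0) := by
          refine sum_congr rfl fun d _ => ?_
          rw [← hcfid d t ht]
  -- the coordinate vector and its support (inside `refl (X ∩ Y)`)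
  obtain ⟨g, hg⟩ : ∃ g : Finset α → ℚ, ∀ e, g e = ∑ d, f d * cf d e := ⟨_, fun _ => rfl⟩
  have hgsupp : ∀ e, g e ≠ 0 → eᶜ ∈ X ∩ Y := by
    intro e he
    rw [hg e] at he
    obtain ⟨d, _, hd⟩ := Finset.exists_ne_zero_of_sum_ne_zero he
    have hfd : f d ≠ 0 := by
      intro h0; apply hd; rw [h0, zero_mul]
    have hcd : cf d e ≠ 0 := by
      intro h0; apply hd; rw [h0, mul_zero]
    obtain ⟨heY, hed⟩ := hcfsupp d e hcd
    have heX : eᶜ ∈ X := hX (compl_subset_compl.2 hed) (hf d hfd)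
    exact mem_inter.2 ⟨heX, heY⟩
  -- C1 for `X ∩ Y`: the coordinates vanish
  have hg0 : ∀ e, g e = 0 := by
    refine eq_zero_of_zeta_sum_eq_zero hW g hgsupp (fun t ht => ?_)
    have htY : t ∈ Y := (mem_inter.1 ht).2
    have := transfer t htY
    simp_rw [← hg] at this
    rw [this]
    exact h t ht
  -- hence the relation on all of `Y`
  intro u hu
  rw [← transfer u hu]
  refine Finset.sum_eq_zero fun e _ => ?_
  rw [← hg e, hg0 e, zero_mul]

/-! ### `t = ∅`: the plain certificate works -/

omit [Fintype α] in
/-- `ζ_1 = ζ`: `qzeta 1 d u = [d ⊆ u]`. [this work] -/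
theorem qzeta_one (d u : Finset α) : qzeta 1 d u = if d ⊆ u then (1 : ℚ) else 0 := by
  unfold qzeta
  split_ifs <;> simp

/-- **`CertGenKernelAt X Y ∅ 1`**: with no flip (`E = refl X ∩ Y`) the PLAIN two-copy certificate has trivial kernel, for all up-sets `X, Y`.
Steps: `(A)` at `q = 1` is a zeta relation for `a + c` on `W`; lift it to `Y` (`zeta_sum_eq_zero_lift`, `supp (a + c) ⊆ refl X`); on `E = refl X ∩ Y`
subtract `(E)` ⇒ a zeta relation for `a` on a family containing `supp a` ⇒ `a = 0`; then `c = 0` by C1 for `Y`; then `b = 0` by C2′. [this work] -/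
theorem certGenKernelAt_transl_empty (X Y : Finset (Finset α)) (hX : IsUpperSet (X : Set (Finset α)))
    (hY : IsUpperSet (Y : Set (Finset α))) : CertGenKernelAt X Y (∅ : Finset α) 1 := by
  intro a b c ha hb hc hA hB hE
  -- supports
  have haX : ∀ d, a d ≠ 0 → dᶜ ∈ X := fun d hd => mem_refl.1 (mem_inter.1 (ha d hd)).1
  have hcX : ∀ d, c d ≠ 0 → dᶜ ∈ X := fun d hd => (mem_inter.1 (mem_refl.1 (hc d hd))).1
  have hcY : ∀ d, c d ≠ 0 → dᶜ ∈ Y := fun d hd => (mem_inter.1 (mem_refl.1 (hc d hd))).2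
  -- (A) at q = 1: a zeta relation for `a + c` on `W`
  have hAW : ∀ u, u ∈ X ∩ Y → ∑ d, (a d + c d) * (if d ⊆ u then (1 : ℚ) else 0) = 0 := by
    intro u hu
    have h1 := hA u hu
    simp_rw [qzeta_one] at h1
    rw [← Finset.sum_add_distrib] at h1
    simpa only [add_mul] using h1
  -- lift it to `Y`
  have hAY := zeta_sum_eq_zero_lift X Y hX hY (fun d => a d + c d) (fun d hd => by
      by_cases h0 : a d = 0
      · rw [h0, zero_add] at hd; exact hcX d hd
      · exact haX d h0) hAW
  -- (E) on `E = refl X ∩ Y`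
  have hEY : ∀ u, u ∈ refl X ∩ Y → ∑ d, c d * (if d ⊆ u then (1 : ℚ) else 0) = 0 := by
    intro u hu
    refine hE u ?_
    rw [transl_empty]
    exact hu
  -- isolate `a` on `refl X ∩ Y ⊇ supp a`
  have ha0 : ∀ d, a d = 0 := by
    refine eq_zero_of_zeta_sum_eq_zero_of_support (refl X ∩ Y) a ha (fun u hu => ?_)
    have h1 := hAY u (mem_inter.1 hu).2
    have h2 := hEY u hu
    have h3 : ∑ d, (a d + c d) * (if d ⊆ u then (1 : ℚ) else 0)
        = ∑ d, a d * (if d ⊆ u then (1 : ℚ) else 0) + ∑ d, c d * (if d ⊆ u then (1 : ℚ) else 0) := by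
      rw [← Finset.sum_add_distrib]
      exact sum_congr rfl fun d _ => by ring
    rw [h3, h2, add_zero] at h1
    exact h1
  -- `c = 0` by C1 for `Y`
  have hc0 : ∀ d, c d = 0 := by
    refine eq_zero_of_zeta_sum_eq_zero hY c hcY (fun u hu => ?_)
    have h1 := hAY u hu
    have h3 : ∑ d, (a d + c d) * (if d ⊆ u then (1 : ℚ) else 0) = ∑ d, c d * (if d ⊆ u then (1 : ℚ) else 0) :=
      sum_congr rfl fun d _ => by rw [ha0 d, zero_add]
    rw [h3] at h1
    exact h1
  -- `b = 0` by C2′ for `(Y, X)`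
  have hb0 : ∀ d, b d = 0 := by
    refine eq_zero_of_zeta_sum_eq_zero_inter Y X hY hX b (fun d hd => ?_) (fun u hu => ?_)
    · have := mem_inter.1 (hb d hd)
      exact mem_inter.2 ⟨this.2, this.1⟩
    · have hu' : u ∈ X ∩ Y := by rw [inter_comm]; exact hu
      have h1 := hB u hu'
      have h2 : ∑ d, a d * qzeta 1 d u = 0 := Finset.sum_eq_zero fun d _ => by rw [ha0 d, zero_mul]
      rw [h2, zero_add] at h1
      exact h1
  exact ⟨ha0, hb0, hc0⟩

end FiveUpSet

end Summit.CriticalPhenomena.PercolationContinuityZ3.Theorems
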